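import Mathlib
import Summits.FinalStateConjecture.FinalStateConjecture.Theorems.PhotonSphereChannelsFarKernel
import Summits.FinalStateConjecture.FinalStateConjecture.Theorems.PhotonSphereChannelsFarKernelEnergy

/-!
# Route PhotonSphereChannels — the true far kernel elements lie in `P_far(ρ)` and radiate nothing

Helper file for the FAR half of `FixedModeChannels` (stmt-FinalStateConjecture-10048): the
consumer-facing packaging of `farKernel_tPolynomial` (construction + asymptotics) and
`farKernel_channelEnergy` (decay of channel energies) in the EXACT vocabulary of the far hypothesis
`hfar` of `fixedModeChannels_of_near_far` — the far cone `Ω = {z | xc + ρ + |z.1| < z.2}`, the kernel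
`P = {p | ContDiffOn ℝ 2 (uncurry p) Ω ∧ (∀ z ∈ Ω, IsSol p z) ∧ ∃ N a, ∀ z ∈ Ω, p z.1 z.2 = Σ_{i<N} a i z.2 · z.1^i}`
and the channel energies `∫⁻_{Ioi (xc+ρ+|t|)} ofReal (e p t x)`. For every `N ≤ ℓ` and every `ρ`
with `xc + ρ ≥ x₀ + X_far(M, ℓ)` (`x₀ = xc − r*(3M)`), `farKernel_mem` gives an element `p_N ∈ P`
whose channel energies tend to `0` as `t → ±∞` (so both `liminf`s vanish) and are finite, and whose
Cauchy data at `t = 0` are the asymptotic monomials `(κ y^{N−ℓ}(1 + O(y^{-1/2})), 0)` (even `N`) /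
`(0, κ y^{N−1−ℓ}(1 + O(y^{-1/2})))` (odd `N`), `κ ≠ 0`, `y = x − x₀` — the `ℓ + 1` true kernel
directions of the far channel estimate.
-/

noncomputable section

namespace Summit.FinalStateConjecture.FinalStateConjecture.Theorems

open Literature.Barriers.FinalStateConjecture MeasureTheory Set Filter Topology Real

variable {M : ℝ} {r : ℝ → ℝ} {xc : ℝ}

/-- **True far kernel elements: membership in `P_far(ρ)`, vanishing channel energies, data.**
See the module docstring. -/
theorem farKernel_mem (hM : 0 < M) (hr : ∀ x, 2 * M < r x)
    (hr' : ∀ x, HasDerivAt r (1 - 2 * M / r x) x) (hxc : r xc = 3 * M) {s : ℕ} (hs : s ≤ 2)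
    (ℓ N : ℕ) (hN : N ≤ ℓ) {ρ : ℝ}
    (hρ : xc - efTortoiseCoord M (3 * M)
      + (64 * M ^ 2 + 2 * M + 1 + 144 * (32 * M * ((ℓ : ℝ) * ((ℓ : ℝ) + 1) + 3)) ^ 2) ≤ xc + ρ) :
    let x₀ : ℝ := xc - efTortoiseCoord M (3 * M)
    let V : ℝ → ℝ := fun x => (1 - 2 * M / r x) * ((ℓ : ℝ) * ((ℓ : ℝ) + 1) / r x ^ 2
      + (1 - (s : ℝ) ^ 2) * (2 * M) / r x ^ 3)
    let e : (ℝ → ℝ → ℝ) → ℝ → ℝ → ℝ := fun φ t x =>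
      deriv (fun τ => φ τ x) t ^ 2 + deriv (φ t) x ^ 2 + V x * φ t x ^ 2
    let IsSol : (ℝ → ℝ → ℝ) → ℝ × ℝ → Prop := fun φ z =>
      iteratedDeriv 2 (fun τ => φ τ z.2) z.1 - iteratedDeriv 2 (φ z.1) z.2 + V z.2 * φ z.1 z.2 = 0
    let Ω : Set (ℝ × ℝ) := {z | xc + ρ + |z.1| < z.2}
    ∃ (p : ℝ → ℝ → ℝ) (κ K : ℝ),
      (ContDiffOn ℝ 2 (Function.uncurry p) Ω ∧ (∀ z ∈ Ω, IsSol p z)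
        ∧ ∃ (Np : ℕ) (a : ℕ → ℝ → ℝ), ∀ z ∈ Ω, p z.1 z.2 = ∑ i ∈ Finset.range Np, a i z.2 * z.1 ^ i)
      ∧ Tendsto (fun t => ∫⁻ x in Ioi (xc + ρ + |t|), ENNReal.ofReal (e p t x)) atTop (𝓝 0)
      ∧ Tendsto (fun t => ∫⁻ x in Ioi (xc + ρ + |t|), ENNReal.ofReal (e p t x)) atBot (𝓝 0)
      ∧ (∀ t, (∫⁻ x in Ioi (xc + ρ + |t|), ENNReal.ofReal (e p t x)) < ⊤)
      ∧ κ ≠ 0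
      ∧ (Even N → ∀ x, xc + ρ < x →
          deriv (fun τ => p τ x) 0 = 0
          ∧ |p 0 x - κ * (x - x₀) ^ ((N : ℝ) - ℓ)| ≤ K * (x - x₀) ^ ((N : ℝ) - ℓ - 1 / 2)
          ∧ |deriv (p 0) x - κ * ((N : ℝ) - ℓ) * (x - x₀) ^ ((N : ℝ) - ℓ - 1)|
              ≤ K * (x - x₀) ^ ((N : ℝ) - ℓ - 1 - 1 / 2))
      ∧ (¬ Even N → ∀ x, xc + ρ < x →
          p 0 x = 0
          ∧ |deriv (fun τ => p τ x) 0 - κ * (x - x₀) ^ ((N : ℝ) - 1 - ℓ)|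
              ≤ K * (x - x₀) ^ ((N : ℝ) - 1 - ℓ - 1 / 2)) := by
  intro x₀ V e IsSol Ω
  set X : ℝ := 64 * M ^ 2 + 2 * M + 1 + 144 * (32 * M * ((ℓ : ℝ) * ((ℓ : ℝ) + 1) + 3)) ^ 2 with hX
  have hρ' : x₀ + X ≤ xc + ρ := hρ
  obtain ⟨p, C, κ, K, K₂, hp, hpC2, hpsol, hprep, heven, hodd, hκ0, hκrec, hκne, hlev⟩ :=
    farKernel_tPolynomial hM hr hr' hxc hs ℓ N hN
  have hX1 : 1 ≤ X := by
    rw [hX]; nlinarith [sq_nonneg M, sq_nonneg (32 * M * ((ℓ : ℝ) * ((ℓ : ℝ) + 1) + 3))]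
  -- the cone sits inside the good half-strip
  have hΩ : ∀ z : ℝ × ℝ, z ∈ Ω → x₀ + X < z.2 := by
    intro z hz
    have h : xc + ρ + |z.1| < z.2 := hz
    linarith [abs_nonneg z.1]
  -- potential bound on the half-strip
  have hVB : ∀ x, x₀ + X < x → V x ≤ 4 * ((ℓ : ℝ) * ((ℓ : ℝ) + 1) + 1) / (x - x₀) ^ 2 := by
    intro x hx
    have hx' : 64 * M ^ 2 + 2 * M + 1 ≤ x - (xc - efTortoiseCoord M (3 * M)) := by
      show 64 * M ^ 2 + 2 * M + 1 ≤ x - x₀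
      have : 64 * M ^ 2 + 2 * M + 1 ≤ X := by
        rw [hX]; nlinarith [sq_nonneg (32 * M * ((ℓ : ℝ) * ((ℓ : ℝ) + 1) + 3))]
      linarith
    exact rwPotential_tortoise_le_far hM hr hr' hxc s ℓ hx'
  -- channel energies
  have hCd : ∀ m, 2 * m ≤ N → DifferentiableOn ℝ (C m) (Ioi (x₀ + X)) := fun m hm =>
    (hlev m hm).1.differentiableOn (by decide)
  obtain ⟨-, htop, hbot, hfin⟩ := farKernel_channelEnergy (V := V) hN hX1 hp hCd
    (fun m hm x hx => (hlev m hm).2.2.2.1 x hx) (fun m hm x hx => (hlev m hm).2.2.2.2 x hx) hVB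
    (by positivity)
  refine ⟨p, κ (N / 2), K, ⟨?_, fun z hz => hpsol z.1 z.2 (hΩ z hz), ?_⟩, ?_, ?_, fun t => ?_,
    hκne (N / 2) (Nat.mul_div_le N 2), fun hev x hx => ?_, fun hod x hx => ?_⟩
  · exact hpC2.mono fun z hz => ⟨Set.mem_univ _, hΩ z hz⟩
  · obtain ⟨Np, a, ha⟩ := hprep
    exact ⟨Np, a, fun z _ => ha z.1 z.2⟩
  · have h := htop (xc + ρ) hρ'
    exact h
  · have h := hbot (xc + ρ) hρ'
    exact h
  · exact hfin (xc + ρ) hρ' t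
  · -- even `N`: data `(C (N/2), 0)`, exponent `2 (N/2) − ℓ = N − ℓ`
    have hx' : x₀ + X < x := by linarith
    obtain ⟨h1, h2⟩ := heven hev x
    have hcast : (2 * ((N / 2 : ℕ) : ℝ)) = (N : ℝ) := by
      obtain ⟨k, hk⟩ := hev
      have : N / 2 = k := by omega
      rw [this]; subst hk; push_cast; ring
    obtain ⟨-, h3, h4, -, -⟩ := hlev (N / 2) (Nat.mul_div_le N 2)
    refine ⟨h2, ?_, ?_⟩
    · have h := h3 x hx'
      rw [hcast] at h
      rw [h1]; exact h
    · have h := h4 x hx'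
      rw [hcast] at h
      have e1 : p 0 = C (N / 2) := funext fun z => (heven hev z).1
      rw [e1]; exact h
  · -- odd `N`: data `(0, C (N/2))`, exponent `2 (N/2) − ℓ = N − 1 − ℓ`
    have hx' : x₀ + X < x := by linarith
    obtain ⟨h1, h2⟩ := hodd hod x
    have hcast : (2 * ((N / 2 : ℕ) : ℝ)) = (N : ℝ) - 1 := by
      rcases Nat.even_or_odd N with h | ⟨k, hk⟩
      · exact absurd h hod
      · have : N / 2 = k := by omega
        rw [this]; subst hk; push_cast; ring
    obtain ⟨-, h3, -, -, -⟩ := hlev (N / 2) (Nat.mul_div_le N 2)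
    refine ⟨h1, ?_⟩
    have h := h3 x hx'
    rw [hcast] at h
    rw [h2]; exact h

end Summit.FinalStateConjecture.FinalStateConjecture.Theorems
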